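import Literature.AlgebraicGeometry.Motives.AbelianVarietyCotangentBaseChangeIso
import Literature.AlgebraicGeometry.Motives.AbelianVarietyLieAlgebra
import Literature.AlgebraicGeometry.Motives.AbelianVarietyConjugate
import Mathlib.LinearAlgebra.Charpoly.BaseChange
import Mathlib.LinearAlgebra.Charpoly.ToMatrix
import HarnessLib

/-!
# The characteristic polynomial of an endomorphism on the cotangent space / Lie algebra under base change
# and under conjugation (`char(u_L | T_e^* A_L) = char(u | T_e^* A)`, `char(Lie u^σ) = σ(char(Lie u))`)

Topic `AlgebraicGeometry/Motives`; namespace `Literature.AlgebraicGeometry.Motives.AbelianVariety`.  THEOREMS ONLY.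
Cell hodgecm-mathlib, fan B, rung B-II, row II-1 v2 stub S8 `stub_conjugateType`, milestone M-a of B-p15's plan
(STATUS 2026-08-28T03:35Z): the one-line transport behind «`δι(ξ)^σ ω_i^σ = ξ^{φ_i σ} ω_i^σ` … `S(ι(ξ)^σ)` has the
characteristic roots `ξ^{φ_1 σ}, …`» ([Shimura1998] §8.5, p. 89 L1) — the representation of `End(A)` on the invariant
differentials (cotangent space at the origin) of the CONJUGATE variety `A^σ` has characteristic polynomials the
`σ`-images of those of `A`.  HC_CM is proved only modulo the 7 printed citations until rung 0 closes; nothing here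
changes that.

## Statements

* `charpoly_cotangentMap_baseChange`: for `u ∈ End_K(A)` and a field extension `L/K`,
  `char(T_e^*(u_L)) = char(T_e^*(u))` mapped to `L[X]` — the tree's `cotangentMap_baseChange_eq_conj`
  (`T_e^*(u_L) = e ∘ (T_e^*(u) ⊗ 1) ∘ e⁻¹`, [GortzWedhorn2020] Rem. 6.12) with Mathlib `LinearEquiv.charpoly_conj` and
  `LinearMap.charpoly_baseChange`; `charpoly_lieMap_baseChange` (Lie algebra = dual, `charpoly_lieMap`).
* `charpoly_lieMap_baseChangeAlong`: along a ring homomorphism `σ : K → L` (`baseChangeAlong`, the tree's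
  `AlongHom L σ` with `algebraMap = σ`), `char(Lie(σu)) = σ(char(Lie u))`; in particular
  `charpoly_lieMap_conjugate`: `char(Lie(u^σ) | Lie A^σ) = σ(char(Lie u | Lie A))` for `σ ∈ Aut(K)` — [Shimura1998]
  §8.5 p. 89 L1 / [Milne2005ShimuraVarieties] §11 («`σ(A, i)` has type `σΦ`») on the Lie algebra.

## References
* [Shimura1998] G. Shimura, *Abelian Varieties with Complex Multiplication and Modular Functions* (1998), §8.5, p. 89
  (held chunk p0089 L1).
* [GortzWedhorn2020] U. Görtz, T. Wedhorn, *Algebraic Geometry I* (2nd ed.), Remark 6.3 (3), Remark 6.12 (base change of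
  tangent/cotangent spaces).
* [Milne2005ShimuraVarieties] J. S. Milne, *Introduction to Shimura varieties* (2005), §11 p. 108.
-/

set_option autoImplicit false

noncomputable section

universe u

open CategoryTheory Polynomial

namespace Literature.AlgebraicGeometry.Motives

namespace AbelianVariety

section BaseChange

variable {K : Type u} [Field K] (L : Type u) [Field L] [Algebra K L] {A : AbelianVariety K}

/-- **`char(T_e^*(u_L)) = char(T_e^*(u))` in `L[X]`**: the characteristic polynomial of the cotangent representation is
invariant under base change of the field (`T_e^*(u_L)` is the base change of `T_e^*(u)` up to the canonical
isomorphism `L ⊗_K T_e^*A ≅ T_e^* A_L`, [GortzWedhorn2020] Rem. 6.12; Mathlib `LinearEquiv.charpoly_conj`,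
`LinearMap.charpoly_baseChange`). [cite: GortzWedhorn2020, Remark 6.3 (3) and Remark 6.12 (2)–(3)] -/
theorem charpoly_cotangentMap_baseChange (u : A ⟶ A) :
    (cotangentMap (A.baseChange L) (Hom.baseChange L u)).charpoly =
      (cotangentMap A u).charpoly.map (algebraMap K L) := by
  rw [cotangentMap_baseChange_eq_conj]
  have h : (cotangentBaseChange L A).toLinearMap ∘ₗ (cotangentMap A u).baseChange L ∘ₗ
      (cotangentBaseChange L A).symm.toLinearMap =
      (cotangentBaseChange L A).conj ((cotangentMap A u).baseChange L) := by
    rw [LinearEquiv.conj_apply, LinearMap.comp_assoc]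
  rw [h, LinearEquiv.charpoly_conj, LinearMap.charpoly_baseChange]

/-- **`char(Lie(u_L)) = char(Lie(u))` in `L[X]`** (the Lie algebra is the dual of the cotangent space; `charpoly_lieMap`).
[cite: GortzWedhorn2020, Remark 6.12 (2)–(3)] -/
theorem charpoly_lieMap_baseChange (u : A ⟶ A) :
    (lieMap (A.baseChange L) (Hom.baseChange L u)).charpoly = (lieMap A u).charpoly.map (algebraMap K L) := by
  rw [charpoly_lieMap, charpoly_lieMap, charpoly_cotangentMap_baseChange]

/-- **`det(Lie(u_L)) = det(Lie(u))` in `L`.** [cite: GortzWedhorn2020, Remark 6.12 (2)–(3)] -/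
theorem det_lieMap_baseChange (u : A ⟶ A) :
    LinearMap.det (lieMap (A.baseChange L) (Hom.baseChange L u)) = algebraMap K L (LinearMap.det (lieMap A u)) := by
  rw [det_lieMap, det_lieMap, det_cotangentMap_baseChange]

end BaseChange

section Along

variable {K : Type u} [Field K] {L : Type u} [Field L] {A : AbelianVariety K}

/-- **`char(Lie(σu) | Lie(σA)) = σ(char(Lie u | Lie A))`** for the base change `σA` along a ring homomorphism
`σ : K → L` (the tree's `baseChangeAlong σ = baseChange (AlongHom L σ)`, `algebraMap K (AlongHom L σ) = σ`):
[Shimura1998] §8.5 p. 89 L1 («`S(ι(ξ)^σ)` has the characteristic roots `ξ^{φ_1σ}, …, ξ^{φ_nσ}`»), [Milne2005ShimuraVarieties]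
§11 p. 108. [cite: Shimura1998, §8.5 p. 89 L1] [cite: Milne2005ShimuraVarieties, §11 p. 108] -/
theorem charpoly_lieMap_baseChangeAlong (σ : K →+* L) (u : A ⟶ A) :
    (lieMap (A.baseChangeAlong σ) (Hom.baseChangeAlong σ u)).charpoly = (lieMap A u).charpoly.map σ :=
  charpoly_lieMap_baseChange (AlongHom L σ) u

/-- **`det(Lie(σu)) = σ(det(Lie u))`.** [cite: Shimura1998, §8.5 p. 89 L1] -/
theorem det_lieMap_baseChangeAlong (σ : K →+* L) (u : A ⟶ A) :
    LinearMap.det (lieMap (A.baseChangeAlong σ) (Hom.baseChangeAlong σ u)) = σ (LinearMap.det (lieMap A u)) :=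
  det_lieMap_baseChange (AlongHom L σ) u

/-- **`char(Lie(u^σ) | Lie A^σ) = σ(char(Lie u | Lie A))` for the conjugate `A^σ`, `σ ∈ Aut(K)`** — the tangent
representation of the conjugate structure `(A^σ, ι^σ)` has the `σ`-conjugate characteristic polynomials ([Shimura1998]
§8.5 p. 89 L1; this is why `(A^σ, ι^σ)` is of type `(K, Φσ)`). [cite: Shimura1998, §8.5 p. 89 L1]
[cite: Milne2005ShimuraVarieties, §11 p. 108] -/
theorem charpoly_lieMap_conjugate (σ : K ≃+* K) (u : A ⟶ A) :
    (lieMap (A.conjugate σ) (Hom.conjugate σ u)).charpoly = (lieMap A u).charpoly.map σ.toRingHom :=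
  charpoly_lieMap_baseChangeAlong σ.toRingHom u

/-- **`det(Lie(u^σ)) = σ(det(Lie u))`.** [cite: Shimura1998, §8.5 p. 89 L1] -/
theorem det_lieMap_conjugate (σ : K ≃+* K) (u : A ⟶ A) :
    LinearMap.det (lieMap (A.conjugate σ) (Hom.conjugate σ u)) = σ (LinearMap.det (lieMap A u)) :=
  det_lieMap_baseChangeAlong σ.toRingHom u

end Along

end AbelianVariety

end Literature.AlgebraicGeometry.Motives

end
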